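import Summits.AtomisticToContinuum.BoseEinsteinCondensation.Theorems.BECThomsonPrinciplePeriodicToDirichletDefs
import Literature.MathematicalPhysics.QuantumManyBody.BoseGasMergeOccupation

/-!
# Route `BECThomsonPrinciple`, crux `PeriodicToDirichlet` (stmt-AtomisticToContinuum-9483),
# line `reward-pays-the-wall` — stub `stub_mergeOccupation`

The registered stub `stub_mergeOccupation : MergeOccupation` of the line's skeleton: occupations
`⟨φ, γ φ⟩` are superadditive under Ruelle's merge (`SupportedState.merge`,
`BoseGasThermodynamicLimitRuelle.lean`) of Dirichlet states with disjoint supports. It is the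
Literature theorem
`Literature.MathematicalPhysics.QuantumManyBody.BoseGas.occupation_le_occupation_merge`
(`BoseGasMergeOccupation.lean`: the one-particle density matrix of the merged state is
`γ_{Ψ₁} ⊕ γ_{Ψ₂}`, of which the lower bound by `γ_{Ψ₁}` is proved there), specialised to the
statement `MergeOccupation` of the Defs file (its measurability hypotheses on the regions are not
needed).

References: Ruelle 1969, §3.5.11 (the merge); LSSY 2005, §1.2 (1.17) (`γ`).
-/

noncomputable section

namespace Summit.AtomisticToContinuum.BoseEinsteinCondensation.RewardPaysTheWall

open Literature.MathematicalPhysics.QuantumManyBody.BoseGas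

/-- **Stub 1c of the line `reward-pays-the-wall`: occupations are superadditive under merging.**
For `SupportedState`s `Ψ₁`, `Ψ₂` of `N₁`, `N₂` bosons on disjoint (measurable) regions and an
a.e.-strongly measurable mode `φ`, `⟨φ, γ_{Ψ₁} φ⟩ ≤ ⟨φ, γ_{Ψ₁.merge Ψ₂} φ⟩`
(`occupation_le_occupation_merge`). [folklore] -/
theorem stub_mergeOccupation : MergeOccupation :=
  fun hdisj _ _ Ψ₁ Ψ₂ _ hφ => occupation_le_occupation_merge hdisj Ψ₁ Ψ₂ hφ

end Summit.AtomisticToContinuum.BoseEinsteinCondensation.RewardPaysTheWall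

end
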